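import Mathlib.AlgebraicGeometry.EllipticCurve.Reduction
import Mathlib.RingTheory.DedekindDomain.AdicValuation
import Mathlib.NumberTheory.NumberField.Completion.FinitePlace
import HarnessLib

-- provenance: harness21/H21/H21/Prelude/DiophValNum/LocalReduction.lean @ 8ab0aae (interim HEAD d8f2665); M5 mechanical rewrite
/-!
# Reduction types of a Weierstrass curve at a finite place

Trunk: `DiophValNum` (item C1 `LocalReduction`).

Let `A` be a Dedekind domain with fraction field `K`, `v : HeightOneSpectrum A` a finite place
(= height-one prime of `A`) and `W : WeierstrassCurve K`. Write `K_v := v.adicCompletion K` for the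
`v`-adic completion and `O_v := v.adicCompletionIntegers K` for its valuation ring (a discrete valuation
ring, `IsDedekindDomain.HeightOneSpectrum` instances in
`Mathlib/NumberTheory/NumberField/Completion/FinitePlace.lean`, with `IsFractionRing O_v K_v`).

Mathlib (`Mathlib/AlgebraicGeometry/EllipticCurve/Reduction.lean`) already provides, for a DVR `R` with
fraction field, the predicates `WeierstrassCurve.IsIntegral R`, `IsMinimal R`, the minimal model
`WeierstrassCurve.minimal R`, `integralModel R`, and the reduction types `HasGoodReduction R`,
`HasMultiplicativeReduction R`, `HasSplitMultiplicativeReduction R`, `HasAdditiveReduction R` together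
with the local trichotomy. We do **not** redefine any of these. This file only packages them into
`Prop`-valued predicates on a *global* curve `W / K` at a place `v`, following the library-wide
convention (the same as Mathlib's `WeierstrassCurve.LFunction`):

* a local predicate "at `v`" on `W` is the Mathlib predicate applied to `W.baseChange K_v` with respect
  to `O_v`; the in-`K` valuation ring `(v.valuation K).integer` is used only in the comparison lemma
  `WeierstrassCurve.isMinimalAt_iff_isMinimal_integer`.

## Main definitions

* `WeierstrassCurve.IsIntegralAt v W`, `WeierstrassCurve.IsMinimalAt v W`: `W` is `v`-integral, resp. a
  minimal Weierstrass equation at `v` (Silverman, AEC VII.1).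
* `WeierstrassCurve.localMinimalModel v W : WeierstrassCurve K_v`: a minimal model of `W` over `K_v`, and
  `WeierstrassCurve.localMinimalIntegralModel v W : WeierstrassCurve O_v`, its integral model (the curve on
  which `ord_v (Δ_min)` and Tate's algorithm are computed downstream).
* `WeierstrassCurve.HasGoodReductionAt v W`, `HasMultiplicativeReductionAt`,
  `HasSplitMultiplicativeReductionAt`, `HasAdditiveReductionAt`, `IsSemistableAt` (Silverman, AEC VII.5).
* `WeierstrassCurve.IsSemistable A W`, `WeierstrassCurve.badPlaces A W`.

## Design notes

* All declarations live in `namespace WeierstrassCurve`: this is a deliberate dot-notation extension of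
  a Mathlib namespace (so that one writes `W.HasGoodReductionAt v`), as sanctioned by the outline.
* `A` is implicit in every declaration taking `v` (it is inferred from `v`), explicit in the global ones.
* The definitions of this file (the eight `Prop`-valued predicates `IsIntegralAt`, `IsMinimalAt`,
  `Has…ReductionAt`, `IsSemistableAt`, `IsSemistable`, and `localMinimalModel`,
  `localMinimalIntegralModel`, `badPlaces`) take `v` / `W` as *explicit binders*, not as section
  variables: they are notions (predicates in `v`, `W`), not named facts — e.g. `W.IsMinimalAt v`
  fails for `W = ⟨1/2, 0, 0, 0, 0⟩ / ℚ` at `v = 2` — and explicit parameters are what tells a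
  predicate apart from a closed named fact `def X : Prop := …` in the library's fact census. The
  named facts of the API sections below keep the section variables `v W`.
* The reduction-type predicates are plain `def … : Prop` (not classes): they refer to the *chosen*
  minimal model `W.localMinimalModel v`; independence of that choice is recorded by the `_smul_iff`
  lemmas (Silverman, AEC VII.5, Prop. 5.1 remark / VII.1.3(b)). These invariance lemmas for the
  multiplicative / split multiplicative / additive types (and hence for semistability) carry the
  hypothesis `[W.IsElliptic]`: for `Δ = 0` Mathlib's `IsMinimal` is satisfied by *every* integral
  model, `WeierstrassCurve.minimal` is then an arbitrary choice, and the reduction type of that choice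
  is not an isomorphism invariant. Good reduction (`v (Δ) = 1`) forces `Δ ≠ 0`, so
  `hasGoodReductionAt_smul_iff` and `badPlaces_smul` need no such hypothesis.

## References

* J. H. Silverman, *The Arithmetic of Elliptic Curves*, GTM 106, 2nd ed. 2009, §§VII.1, VII.5, VIII.8.
-/

open IsDedekindDomain

namespace WeierstrassCurve

section Local

variable {A : Type*} [CommRing A] [IsDedekindDomain A] {K : Type*} [Field K]
  [Algebra A K] [IsFractionRing A K]

/-- `W.IsIntegralAt v`: the Weierstrass equation `W / K` has `v`-integral coefficients, i.e. its base
change to the completion `K_v` is integral with respect to `O_v = v.adicCompletionIntegers K`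
(Mathlib's `WeierstrassCurve.IsIntegral`). Silverman, AEC VII.1.
(Dot-notation extension of the Mathlib namespace `WeierstrassCurve`.) [folklore] -/
abbrev IsIntegralAt (v : HeightOneSpectrum A) (W : WeierstrassCurve K) : Prop :=
  (W.baseChange (v.adicCompletion K)).IsIntegral (v.adicCompletionIntegers K)

/-- `W.IsMinimalAt v`: the Weierstrass equation `W / K` is a *minimal* Weierstrass equation at the
finite place `v`, i.e. its base change to `K_v` is `v`-integral and `ord_v (Δ)` is minimal among all
`K_v`-isomorphic integral equations (Mathlib's `WeierstrassCurve.IsMinimal` over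
`O_v = v.adicCompletionIntegers K`). Silverman, AEC VII.1.
(Dot-notation extension of the Mathlib namespace `WeierstrassCurve`.) [folklore] -/
abbrev IsMinimalAt (v : HeightOneSpectrum A) (W : WeierstrassCurve K) : Prop :=
  (W.baseChange (v.adicCompletion K)).IsMinimal (v.adicCompletionIntegers K)

/-- A (chosen) minimal Weierstrass model of `W` over the completion `K_v`, namely Mathlib's
`WeierstrassCurve.minimal O_v` applied to `W.baseChange K_v`. It is `K_v`-isomorphic to
`W.baseChange K_v`. Silverman, AEC VII.1, Prop. 1.3(a).
(Dot-notation extension of the Mathlib namespace `WeierstrassCurve`.) [folklore] -/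
noncomputable def localMinimalModel (v : HeightOneSpectrum A) (W : WeierstrassCurve K) :
    WeierstrassCurve (v.adicCompletion K) :=
  (W.baseChange (v.adicCompletion K)).minimal (v.adicCompletionIntegers K)

/-- The chosen local minimal model is minimal (instance on the new H21 definition
`WeierstrassCurve.localMinimalModel`; it is Mathlib's instance for `WeierstrassCurve.minimal`,
transported through the definition). Silverman, AEC VII.1, Prop. 1.3(a). [folklore] -/
instance instIsMinimalLocalMinimalModel (v : HeightOneSpectrum A) (W : WeierstrassCurve K) :
    (W.localMinimalModel v).IsMinimal (v.adicCompletionIntegers K) := by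
  unfold localMinimalModel; infer_instance

/-- The integral model over `O_v = v.adicCompletionIntegers K` of the chosen local minimal model
`W.localMinimalModel v` (Mathlib's `WeierstrassCurve.integralModel`). This is the Weierstrass equation
with `v`-integral coefficients on which `ord_v (Δ_min)`, the reduction and Tate's algorithm are
computed. Silverman, AEC VII.1.
(Dot-notation extension of the Mathlib namespace `WeierstrassCurve`.) [folklore] -/
noncomputable def localMinimalIntegralModel (v : HeightOneSpectrum A) (W : WeierstrassCurve K) :
    WeierstrassCurve (v.adicCompletionIntegers K) :=
  (W.localMinimalModel v).integralModel (v.adicCompletionIntegers K)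

/-- `W.HasGoodReductionAt v`: `W / K` has good reduction at the finite place `v`, i.e. a minimal
model at `v` has `v`-unit discriminant (Mathlib's `WeierstrassCurve.HasGoodReduction` for
`W.localMinimalModel v` over `O_v`). Silverman, AEC VII.5.
(Dot-notation extension of the Mathlib namespace `WeierstrassCurve`.) [folklore] -/
def HasGoodReductionAt (v : HeightOneSpectrum A) (W : WeierstrassCurve K) : Prop :=
  (W.localMinimalModel v).HasGoodReduction (v.adicCompletionIntegers K)

/-- `W.HasMultiplicativeReductionAt v`: `W / K` has multiplicative (nodal) reduction at `v`, i.e. for a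
minimal model at `v`, `ord_v (Δ) > 0` and `ord_v (c₄) = 0` (Mathlib's
`WeierstrassCurve.HasMultiplicativeReduction` for `W.localMinimalModel v` over `O_v`).
Silverman, AEC VII.5, Prop. 5.1(b).
(Dot-notation extension of the Mathlib namespace `WeierstrassCurve`.) [folklore] -/
def HasMultiplicativeReductionAt (v : HeightOneSpectrum A) (W : WeierstrassCurve K) : Prop :=
  (W.localMinimalModel v).HasMultiplicativeReduction (v.adicCompletionIntegers K)

/-- `W.HasSplitMultiplicativeReductionAt v`: `W / K` has *split* multiplicative reduction at `v`
(the tangent slopes at the node of the reduction are rational over the residue field; Mathlib's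
`WeierstrassCurve.HasSplitMultiplicativeReduction` for `W.localMinimalModel v` over `O_v`).
Silverman, AEC VII.5 and Ex. 3.5.
(Dot-notation extension of the Mathlib namespace `WeierstrassCurve`.) [folklore] -/
def HasSplitMultiplicativeReductionAt (v : HeightOneSpectrum A) (W : WeierstrassCurve K) : Prop :=
  (W.localMinimalModel v).HasSplitMultiplicativeReduction (v.adicCompletionIntegers K)

/-- `W.HasAdditiveReductionAt v`: `W / K` has additive (cuspidal) reduction at `v`, i.e. for a minimal
model at `v`, `ord_v (Δ) > 0` and `ord_v (c₄) > 0` (Mathlib's `WeierstrassCurve.HasAdditiveReduction`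
for `W.localMinimalModel v` over `O_v`). Silverman, AEC VII.5, Prop. 5.1(c).
(Dot-notation extension of the Mathlib namespace `WeierstrassCurve`.) [folklore] -/
def HasAdditiveReductionAt (v : HeightOneSpectrum A) (W : WeierstrassCurve K) : Prop :=
  (W.localMinimalModel v).HasAdditiveReduction (v.adicCompletionIntegers K)

/-- `W.IsSemistableAt v`: `W / K` is semistable at `v`, i.e. has good or multiplicative reduction
at `v`. Silverman, AEC VII.5 (definition following Prop. 5.1).
(Dot-notation extension of the Mathlib namespace `WeierstrassCurve`.) [folklore] -/
def IsSemistableAt (v : HeightOneSpectrum A) (W : WeierstrassCurve K) : Prop :=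
  W.HasGoodReductionAt v ∨ W.HasMultiplicativeReductionAt v

end Local

section Global

variable (A : Type*) [CommRing A] [IsDedekindDomain A] {K : Type*} [Field K]
  [Algebra A K] [IsFractionRing A K]

/-- `W.IsSemistable A`: `W / K` is semistable, i.e. semistable (good or multiplicative reduction) at
every finite place `v` of `K` over `A` (every height-one prime of `A`). Silverman, AEC VII.5.
(Dot-notation extension of the Mathlib namespace `WeierstrassCurve`.) [folklore] -/
def IsSemistable (W : WeierstrassCurve K) : Prop :=
  ∀ v : HeightOneSpectrum A, W.IsSemistableAt v

/-- `W.badPlaces A`: the set of finite places of `K` over `A` (= height-one primes of the Dedekind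
domain `A`) at which `W / K` does *not* have good reduction. For an elliptic curve this set is finite
(`WeierstrassCurve.finite_badPlaces`). Silverman, AEC VII.5 and VIII.8.
(Dot-notation extension of the Mathlib namespace `WeierstrassCurve`.) [folklore] -/
def badPlaces (W : WeierstrassCurve K) : Set (HeightOneSpectrum A) :=
  {v | ¬ W.HasGoodReductionAt v}

end Global

/-! ### API -/

section LocalAPI

variable {A : Type*} [CommRing A] [IsDedekindDomain A] {K : Type*} [Field K]
  [Algebra A K] [IsFractionRing A K] (v : HeightOneSpectrum A) (W : WeierstrassCurve K)

/-- Local trichotomy: at every finite place `v`, `W / K` has good, multiplicative or additive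
reduction (from Mathlib's `WeierstrassCurve.hasGoodReduction_or_hasMultiplicativeReduction_or_hasAdditiveReduction`
applied to the local minimal model). Silverman, AEC VII.5, Prop. 5.1. [folklore] -/
theorem hasGoodReductionAt_or_hasMultiplicativeReductionAt_or_hasAdditiveReductionAt :
    W.HasGoodReductionAt v ∨ W.HasMultiplicativeReductionAt v ∨ W.HasAdditiveReductionAt v :=
  hasGoodReduction_or_hasMultiplicativeReduction_or_hasAdditiveReduction
    (v.adicCompletionIntegers K)

variable {v W}

/-- Good reduction at `v` excludes multiplicative reduction at `v`. Silverman, AEC VII.5, Prop. 5.1. [folklore] -/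
theorem HasGoodReductionAt.not_hasMultiplicativeReductionAt (h : W.HasGoodReductionAt v) :
    ¬ W.HasMultiplicativeReductionAt v :=
  HasGoodReduction.not_hasMultiplicativeReduction _ h

/-- Good reduction at `v` excludes additive reduction at `v`. Silverman, AEC VII.5, Prop. 5.1. [folklore] -/
theorem HasGoodReductionAt.not_hasAdditiveReductionAt (h : W.HasGoodReductionAt v) :
    ¬ W.HasAdditiveReductionAt v :=
  HasGoodReduction.not_hasAdditiveReduction _ h

/-- Multiplicative reduction at `v` excludes additive reduction at `v`.
Silverman, AEC VII.5, Prop. 5.1. [folklore] -/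
theorem HasMultiplicativeReductionAt.not_hasAdditiveReductionAt
    (h : W.HasMultiplicativeReductionAt v) : ¬ W.HasAdditiveReductionAt v :=
  HasMultiplicativeReduction.not_hasAdditiveReduction _ h

/-- Multiplicative reduction at `v` excludes good reduction at `v`.
Silverman, AEC VII.5, Prop. 5.1. [folklore] -/
theorem HasMultiplicativeReductionAt.not_hasGoodReductionAt
    (h : W.HasMultiplicativeReductionAt v) : ¬ W.HasGoodReductionAt v :=
  HasMultiplicativeReduction.not_hasGoodReduction _ h

/-- Additive reduction at `v` excludes good reduction at `v`. Silverman, AEC VII.5, Prop. 5.1. [folklore] -/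
theorem HasAdditiveReductionAt.not_hasGoodReductionAt (h : W.HasAdditiveReductionAt v) :
    ¬ W.HasGoodReductionAt v :=
  HasAdditiveReduction.not_hasGoodReduction _ h

/-- Additive reduction at `v` excludes multiplicative reduction at `v`.
Silverman, AEC VII.5, Prop. 5.1. [folklore] -/
theorem HasAdditiveReductionAt.not_hasMultiplicativeReductionAt
    (h : W.HasAdditiveReductionAt v) : ¬ W.HasMultiplicativeReductionAt v :=
  HasAdditiveReduction.not_hasMultiplicativeReduction _ h

/-- Split multiplicative reduction at `v` is in particular multiplicative reduction at `v`.
Silverman, AEC VII.5. [folklore] -/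
theorem HasSplitMultiplicativeReductionAt.hasMultiplicativeReductionAt
    (h : W.HasSplitMultiplicativeReductionAt v) : W.HasMultiplicativeReductionAt v :=
  h.toHasMultiplicativeReduction

/-- Good reduction at `v` implies semistability at `v`. Silverman, AEC VII.5. [folklore] -/
theorem HasGoodReductionAt.isSemistableAt (h : W.HasGoodReductionAt v) : W.IsSemistableAt v :=
  Or.inl h

/-- Multiplicative reduction at `v` implies semistability at `v`. Silverman, AEC VII.5. [folklore] -/
theorem HasMultiplicativeReductionAt.isSemistableAt (h : W.HasMultiplicativeReductionAt v) :
    W.IsSemistableAt v :=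
  Or.inr h

variable (v W)

/-- `W` is semistable at `v` iff it does not have additive reduction at `v`.
Silverman, AEC VII.5, Prop. 5.1. [folklore] -/
theorem isSemistableAt_iff_not_hasAdditiveReductionAt :
    W.IsSemistableAt v ↔ ¬ W.HasAdditiveReductionAt v := by
  refine ⟨fun h ↦ h.elim (·.not_hasAdditiveReductionAt) (·.not_hasAdditiveReductionAt), fun h ↦ ?_⟩
  rcases W.hasGoodReductionAt_or_hasMultiplicativeReductionAt_or_hasAdditiveReductionAt v with
    h' | h' | h'
  exacts [Or.inl h', Or.inr h', (h h').elim]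

/-- The reduction type is an isomorphism invariant: good reduction at `v` is unchanged under an
admissible change of variables `C • W` over `K`. Silverman, AEC VII.5, Prop. 5.1 and VII.1,
Prop. 1.3(b) (any two minimal equations are related by a change of variables with `u ∈ O_v^×`,
`r, s, t ∈ O_v`). [cite: SilvermanAEC2009, VII.5 Prop. 5.1 and VII.1 Prop. 1.3(b)] -/
def hasGoodReductionAt_smul_iff : Prop :=
  ∀ (C : VariableChange K),
    (C • W).HasGoodReductionAt v ↔ W.HasGoodReductionAt v

/-- For an elliptic curve (`Δ ≠ 0`), multiplicative reduction at `v` is unchanged under an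
admissible change of variables `C • W` over `K`. Silverman, AEC VII.5, Prop. 5.1 and VII.1,
Prop. 1.3(b). (The hypothesis `[W.IsElliptic]` is needed: for `Δ = 0` the chosen "minimal" model is
arbitrary, see the module docstring.) [cite: SilvermanAEC2009, VII.5 Prop. 5.1 and VII.1 Prop. 1.3(b)] -/
def hasMultiplicativeReductionAt_smul_iff : Prop :=
  ∀ [W.IsElliptic] (C : VariableChange K),
    (C • W).HasMultiplicativeReductionAt v ↔ W.HasMultiplicativeReductionAt v

/-- For an elliptic curve (`Δ ≠ 0`), split multiplicative reduction at `v` is unchanged under an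
admissible change of variables `C • W` over `K`. Silverman, AEC VII.5, Prop. 5.1 and VII.1,
Prop. 1.3(b) (two minimal equations differ by `u ∈ O_v^×`, `r, s, t ∈ O_v`, which induces an
isomorphism of the reduced curves over the residue field). [cite: SilvermanAEC2009, VII.5 Prop. 5.1 and VII.1 Prop. 1.3(b)] -/
def hasSplitMultiplicativeReductionAt_smul_iff : Prop :=
  ∀ [W.IsElliptic] (C : VariableChange K),
    (C • W).HasSplitMultiplicativeReductionAt v ↔ W.HasSplitMultiplicativeReductionAt v

/-- For an elliptic curve (`Δ ≠ 0`), additive reduction at `v` is unchanged under an admissible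
change of variables `C • W` over `K`. Silverman, AEC VII.5, Prop. 5.1 and VII.1, Prop. 1.3(b).
(The hypothesis `[W.IsElliptic]` is needed, see the module docstring.) [cite: SilvermanAEC2009, VII.5 Prop. 5.1 and VII.1 Prop. 1.3(b)] -/
def hasAdditiveReductionAt_smul_iff : Prop :=
  ∀ [W.IsElliptic] (C : VariableChange K),
    (C • W).HasAdditiveReductionAt v ↔ W.HasAdditiveReductionAt v

/-- For an elliptic curve, semistability at `v` is unchanged under an admissible change of
variables `C • W` over `K`. Silverman, AEC VII.5, Prop. 5.1. [folklore] -/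
def isSemistableAt_smul_iff : Prop :=
  ∀ [W.IsElliptic] (C : VariableChange K),
    (C • W).IsSemistableAt v ↔ W.IsSemistableAt v

/- interim proof relied on results that are now named facts (D-0014); demoted to a fact by the M5 import, proof preserved:
:= by
  simp only [IsSemistableAt, hasGoodReductionAt_smul_iff, hasMultiplicativeReductionAt_smul_iff]
-/

variable {v W}

/-- A `v`-integral Weierstrass equation whose discriminant is a `v`-adic unit has good reduction at
`v` (such an equation is automatically minimal at `v`). Silverman, AEC VII.1, Remark 1.1 and VII.5,
Prop. 5.1(a). The valuation `v.valuation K` on `K` agrees with `Valued.v` on `K_v`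
(`IsDedekindDomain.HeightOneSpectrum.valuedAdicCompletion_eq_valuation'`). [cite: SilvermanAEC2009, VII.1 Remark 1.1 and VII.5 Prop. 5.1(a)] -/
def hasGoodReductionAt_of_valuation_Δ_eq_one : Prop :=
  ∀ (hW : W.IsIntegralAt v) (h : v.valuation K W.Δ = 1),
    W.HasGoodReductionAt v

/-- A `v`-integral Weierstrass equation with `ord_v (Δ) < 12`, i.e. `v (Δ) > exp (-12)` in the
multiplicative value group `ℤᵐ⁰`, is minimal at `v`. Silverman, AEC VII.1, Remark 1.1. [cite: SilvermanAEC2009, VII.1 Remark 1.1] -/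
def isMinimalAt_of_lt_valuation_Δ : Prop :=
  ∀ (hW : W.IsIntegralAt v) (h : WithZero.exp (-12 : ℤ) < v.valuation K W.Δ),
    W.IsMinimalAt v

variable (v W)

/-- Comparison of the two conventions for "minimal at `v`": minimality of `W.baseChange K_v` over the
complete DVR `O_v = v.adicCompletionIntegers K` is equivalent to minimality of `W` itself over the
(non-complete) DVR `(v.valuation K).integer ⊆ K`. Both rings have the same value group and
`K ∩ O_v = (v.valuation K).integer`
(`IsDedekindDomain.HeightOneSpectrum.valuedAdicCompletion_eq_valuation'`); this is the only place in
the library where the in-`K` valuation ring appears. Silverman, AEC VII.1 (the definition of minimality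
only involves `ord_v`). [cite: SilvermanAEC2009, VII.1 (definition of minimality)] -/
def isMinimalAt_iff_isMinimal_integer : Prop :=
  W.IsMinimalAt v ↔ W.IsMinimal (v.valuation K).integer

end LocalAPI

section GlobalAPI

variable (A : Type*) [CommRing A] [IsDedekindDomain A] {K : Type*} [Field K]
  [Algebra A K] [IsFractionRing A K] (W : WeierstrassCurve K)

variable {A} in
/-- Membership in `W.badPlaces A` unfolds to "not good reduction at `v`". [folklore] -/
@[simp]
theorem mem_badPlaces_iff (v : HeightOneSpectrum A) :
    v ∈ W.badPlaces A ↔ ¬ W.HasGoodReductionAt v :=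
  Iff.rfl

/-- The set of bad places is an isomorphism invariant of `W / K`. Silverman, AEC VII.5, Prop. 5.1. [folklore] -/
def badPlaces_smul : Prop :=
  ∀ (C : VariableChange K),
    (C • W).badPlaces A = W.badPlaces A

/- interim proof relied on results that are now named facts (D-0014); demoted to a fact by the M5 import, proof preserved:
:= by
  ext v
  simp only [mem_badPlaces_iff, hasGoodReductionAt_smul_iff]
-/

/-- Semistability is an isomorphism invariant of an elliptic curve `W / K`.
Silverman, AEC VII.5, Prop. 5.1. [folklore] -/
def isSemistable_smul_iff : Prop :=
  ∀ [W.IsElliptic] (C : VariableChange K),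
    (C • W).IsSemistable A ↔ W.IsSemistable A

/- interim proof relied on results that are now named facts (D-0014); demoted to a fact by the M5 import, proof preserved:
:= by
  simp only [IsSemistable, isSemistableAt_smul_iff]
-/

/-- An elliptic curve (`Δ ≠ 0`) over the fraction field `K` of a Dedekind domain `A` has good
reduction at all but finitely many finite places: `Δ` and the coefficients are `v`-units for almost
all `v`. Silverman, AEC VII.5, remark before Prop. 5.1, and VIII.8. [cite: SilvermanAEC2009, VII.5 (remark before Prop. 5.1) and VIII.8] -/
def finite_badPlaces : Prop :=
  ∀ [W.IsElliptic],
    (W.badPlaces A).Finite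

end GlobalAPI

end WeierstrassCurve

/-! ### Discharge of `WeierstrassCurve.isMinimalAt_iff_isMinimal_integer`

The comparison "minimal over the complete DVR `O_v` ⊆ `K_v`" versus "minimal over the valuation ring
`(v.valuation K).integer` ⊆ `K`" (Silverman, AEC VII.1, definition p. 165, used implicitly for number
fields in VIII.8, pp. 210–211). Architecture of the proof:

* `isMinimal_iff_of_le_one_iff`: for a DVR `R` with fraction field `L` and *any* valuation `V` on `L`
  whose valuation ring is `R`, Mathlib's `IsMinimal R X` unfolds to "`X` is `R`-integral and every
  `R`-integral `C • X` has `V (C • X).Δ ≤ V X.Δ`" (the adic valuation of `maximalIdeal R` is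
  equivalent to `V`, `IsDiscreteValuationRing.exists_lift_of_le_one`).
* integrality and `V` are read off in `K` (`valued_algebraMap_adicCompletion`,
  `isIntegralAt_iff_isIntegral_integer`);
* `→`: a change of variables over `K` base-changes to `K_v` (`map_variableChange`);
* `←`: a change of variables `⟨u, r, s, t⟩` over `K_v` making the equation `O_v`-integral is
  approximated by `⟨u', r', s', t'⟩` over `K` with `|u'|_v = |u|_v` and still `O_v`-integral, since
  `K` is dense in `K_v` (`denseRange_algebraMap`), `O_v` is open (`Valued.isOpen_valuationSubring`),
  `|·|_v` is locally constant off `0` (`Valued.locally_const`) and the new coefficients are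
  polynomial, hence continuous, in `(u⁻¹, r, s, t)` (`polyVariableChange`).
-/

namespace WeierstrassCurve

section IntegralCriterion

variable {R : Type*} [CommRing R] {L : Type*} [CommRing L] [Algebra R L]

/-- A Weierstrass equation over `L` is `R`-integral iff each of its five coefficients lies in the
image of `R`. [folklore] -/
theorem isIntegral_iff_forall_mem_range {L : Type*} [Field L] [Algebra R L]
    (X : WeierstrassCurve L) :
    X.IsIntegral R ↔ X.a₁ ∈ (algebraMap R L).range ∧ X.a₂ ∈ (algebraMap R L).range ∧
      X.a₃ ∈ (algebraMap R L).range ∧ X.a₄ ∈ (algebraMap R L).range ∧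
      X.a₆ ∈ (algebraMap R L).range := by
  refine ⟨fun ⟨X', hX'⟩ ↦ ?_,
    fun ⟨h₁, h₂, h₃, h₄, h₆⟩ ↦ isIntegral_of_exists_lift R h₁ h₂ h₃ h₄ h₆⟩
  subst hX'
  exact ⟨⟨X'.a₁, rfl⟩, ⟨X'.a₂, rfl⟩, ⟨X'.a₃, rfl⟩, ⟨X'.a₄, rfl⟩, ⟨X'.a₆, rfl⟩⟩

/-- Auxiliary: the coefficients of `⟨w⁻¹, r, s, t⟩ • X` as *polynomial* functions of
`p = (w, r, s, t)` (so that they are continuous in `p` over a topological ring). [folklore] -/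
def polyVariableChange (X : WeierstrassCurve L) (p : L × L × L × L) : WeierstrassCurve L where
  a₁ := p.1 * (X.a₁ + 2 * p.2.2.1)
  a₂ := p.1 ^ 2 * (X.a₂ - p.2.2.1 * X.a₁ + 3 * p.2.1 - p.2.2.1 ^ 2)
  a₃ := p.1 ^ 3 * (X.a₃ + p.2.1 * X.a₁ + 2 * p.2.2.2)
  a₄ := p.1 ^ 4 * (X.a₄ - p.2.2.1 * X.a₃ + 2 * p.2.1 * X.a₂ - (p.2.2.2 + p.2.1 * p.2.2.1) * X.a₁
    + 3 * p.2.1 ^ 2 - 2 * p.2.2.1 * p.2.2.2)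
  a₆ := p.1 ^ 6 * (X.a₆ + p.2.1 * X.a₄ + p.2.1 ^ 2 * X.a₂ + p.2.1 ^ 3 - p.2.2.2 * X.a₃
    - p.2.2.2 ^ 2 - p.2.1 * p.2.2.2 * X.a₁)

/-- `C • X` is `polyVariableChange X` evaluated at `(u⁻¹, r, s, t)`. [folklore] -/
theorem variableChange_eq_polyVariableChange (X : WeierstrassCurve L) (C : VariableChange L) :
    C • X = X.polyVariableChange (↑C.u⁻¹, C.r, C.s, C.t) := rfl

/-- `polyVariableChange` commutes with ring homomorphisms. [folklore] -/
theorem map_polyVariableChange {L' : Type*} [CommRing L'] (φ : L →+* L') (X : WeierstrassCurve L)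
    (p : L × L × L × L) :
    (X.polyVariableChange p).map φ = (X.map φ).polyVariableChange (φ p.1, φ p.2.1, φ p.2.2.1, φ p.2.2.2) := by
  ext <;> simp [polyVariableChange, map, map_ofNat]

variable [TopologicalSpace L] [IsTopologicalRing L] (X : WeierstrassCurve L)

/-- Continuity of the coefficient `a₁` of `polyVariableChange`. [folklore] -/
theorem continuous_polyVariableChange_a₁ : Continuous fun p ↦ (X.polyVariableChange p).a₁ := by
  unfold polyVariableChange; fun_prop

/-- Continuity of the coefficient `a₂` of `polyVariableChange`. [folklore] -/
theorem continuous_polyVariableChange_a₂ : Continuous fun p ↦ (X.polyVariableChange p).a₂ := by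
  unfold polyVariableChange; fun_prop

/-- Continuity of the coefficient `a₃` of `polyVariableChange`. [folklore] -/
theorem continuous_polyVariableChange_a₃ : Continuous fun p ↦ (X.polyVariableChange p).a₃ := by
  unfold polyVariableChange; fun_prop

/-- Continuity of the coefficient `a₄` of `polyVariableChange`. [folklore] -/
theorem continuous_polyVariableChange_a₄ : Continuous fun p ↦ (X.polyVariableChange p).a₄ := by
  unfold polyVariableChange; fun_prop

/-- Continuity of the coefficient `a₆` of `polyVariableChange`. [folklore] -/
theorem continuous_polyVariableChange_a₆ : Continuous fun p ↦ (X.polyVariableChange p).a₆ := by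
  unfold polyVariableChange; fun_prop

end IntegralCriterion

section MinimalCriterion

variable {R : Type*} [CommRing R] [IsDomain R] [IsDiscreteValuationRing R]
  {L : Type*} [Field L] [Algebra R L] [IsFractionRing R L]
  {Γ : Type*} [LinearOrderedCommGroupWithZero Γ] {V : Valuation L Γ}

/-- If `V` is any valuation on the fraction field `L` of a DVR `R` whose valuation ring is `R`, then
`V` is equivalent to the adic valuation of the maximal ideal of `R`. [folklore] -/
theorem isEquiv_valuation_maximalIdeal_of_le_one_iff
    (hV : ∀ x : L, V x ≤ 1 ↔ x ∈ (algebraMap R L).range) :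
    ((IsDiscreteValuationRing.maximalIdeal R).valuation L).IsEquiv V := by
  refine Valuation.isEquiv_iff_val_le_one.mpr fun {x} ↦ ?_
  rw [hV]
  exact ⟨fun h ↦ IsDiscreteValuationRing.exists_lift_of_le_one h,
    fun ⟨r, hr⟩ ↦ hr ▸ HeightOneSpectrum.valuation_le_one _ r⟩

/-- Minimality of a Weierstrass equation over the fraction field `L` of a DVR `R`, expressed with
any valuation `V` on `L` whose valuation ring is `R`: `X` is minimal iff it is integral and no
integral `L`-isomorphic equation has a discriminant of strictly smaller order. [folklore] -/
theorem isMinimal_iff_of_le_one_iff (hV : ∀ x : L, V x ≤ 1 ↔ x ∈ (algebraMap R L).range)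
    (X : WeierstrassCurve L) :
    X.IsMinimal R ↔ X.IsIntegral R ∧
      ∀ C : VariableChange L, (C • X).IsIntegral R → V (C • X).Δ ≤ V X.Δ := by
  rw [isMinimal_iff, MaximalFor]
  simp only [one_smul]
  refine and_congr_right fun hX ↦ forall_congr' fun C ↦ forall_congr' fun hC ↦ ?_
  rw [← Subtype.coe_le_coe, ← Subtype.coe_le_coe, valuation_Δ_aux_eq_of_isIntegral,
    valuation_Δ_aux_eq_of_isIntegral]
  have hE := isEquiv_valuation_maximalIdeal_of_le_one_iff hV
  rw [← hE _ _]
  exact ⟨fun h ↦ (le_total _ _).elim (fun h' ↦ h h') id, fun h _ ↦ h⟩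

end MinimalCriterion

section Comparison

variable {A : Type*} [CommRing A] [IsDedekindDomain A] {K : Type*} [Field K]
  [Algebra A K] [IsFractionRing A K] (v : HeightOneSpectrum A)

/-- The valuation of `K_v` restricted to `K` along `algebraMap K K_v` is `v`. [folklore] -/
theorem valued_algebraMap_adicCompletion (k : K) :
    Valued.v (algebraMap K (v.adicCompletion K) k) = v.valuation K k :=
  HeightOneSpectrum.adicCompletion.valued_coe K v k

/-- The valuation ring of `Valued.v` on `K_v` is `O_v` (in the form needed by
`isMinimal_iff_of_le_one_iff`). [folklore] -/
theorem valued_le_one_iff_mem_range_adicCompletionIntegers (x : v.adicCompletion K) :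
    Valued.v x ≤ 1 ↔
      x ∈ (algebraMap (v.adicCompletionIntegers K) (v.adicCompletion K)).range :=
  ⟨fun h ↦ ⟨⟨x, (HeightOneSpectrum.mem_adicCompletionIntegers A K v).mpr h⟩, rfl⟩,
    fun ⟨y, hy⟩ ↦ hy ▸ (HeightOneSpectrum.mem_adicCompletionIntegers A K v).mp y.2⟩

/-- The valuation ring of `v.valuation K` on `K` is `(v.valuation K).integer` (in the form needed
by `isMinimal_iff_of_le_one_iff`). [folklore] -/
theorem valuation_le_one_iff_mem_range_integer (x : K) :
    v.valuation K x ≤ 1 ↔ x ∈ (algebraMap (v.valuation K).integer K).range :=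
  ⟨fun h ↦ ⟨⟨x, (Valuation.mem_integer_iff _ _).mpr h⟩, rfl⟩,
    fun ⟨y, hy⟩ ↦ hy ▸ (Valuation.mem_integer_iff _ _).mp y.2⟩

/-- `v`-integrality of `X / K` may be tested in `K`: `X.baseChange K_v` is `O_v`-integral iff
`X` is `(v.valuation K).integer`-integral. [folklore] -/
theorem isIntegralAt_iff_isIntegral_integer (X : WeierstrassCurve K) :
    X.IsIntegralAt v ↔ X.IsIntegral (v.valuation K).integer := by
  rw [IsIntegralAt, isIntegral_iff_forall_mem_range, isIntegral_iff_forall_mem_range]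
  simp only [← valued_le_one_iff_mem_range_adicCompletionIntegers,
    ← valuation_le_one_iff_mem_range_integer, baseChange, map_a₁, map_a₂, map_a₃, map_a₄,
    map_a₆, valued_algebraMap_adicCompletion]

variable (W : WeierstrassCurve K)

/-- Discharge of `isMinimalAt_iff_isMinimal_integer`. Both sides say "integral, and no integral
isomorphic equation has smaller `ord_v Δ`" (`isMinimal_iff_of_le_one_iff`); integrality and
`ord_v` are read off in `K` (`valued_algebraMap_adicCompletion`). A change of variables over `K`
base-changes to one over `K_v`; conversely a change of variables `⟨u, r, s, t⟩` over `K_v` making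
the equation integral is approximated by one over `K` with the same `ord_v u` and still integral,
because `K` is dense in `K_v`, `O_v` is open and `ord_v` is locally constant on `K_vˣ`.
Silverman, AEC VII.1 (definition of minimality, p. 165) and VIII.8 (minimal at `v` for a number
field, p. 210–211). [cite: SilvermanAEC2009, VII.1 (definition of minimality)] -/
theorem isMinimalAt_iff_isMinimal_integer_holds : isMinimalAt_iff_isMinimal_integer v W := by
  unfold isMinimalAt_iff_isMinimal_integer IsMinimalAt
  rw [isMinimal_iff_of_le_one_iff (valued_le_one_iff_mem_range_adicCompletionIntegers v),
    isMinimal_iff_of_le_one_iff (valuation_le_one_iff_mem_range_integer v),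
    ← IsIntegralAt, isIntegralAt_iff_isIntegral_integer]
  refine and_congr_right fun hW ↦ ⟨fun H C hC ↦ ?_, fun H C hC ↦ ?_⟩
  · -- a change of variables over `K` base-changes to `K_v`
    have hC' : (C • W).IsIntegralAt v := (isIntegralAt_iff_isIntegral_integer v _).mpr hC
    rw [IsIntegralAt, baseChange, ← map_variableChange] at hC'
    have key := H _ hC'
    simp only [baseChange] at key
    rw [map_variableChange, map_Δ, map_Δ, valued_algebraMap_adicCompletion,
      valued_algebraMap_adicCompletion] at key
    exact key
  · -- a change of variables over `K_v` is approximated by one over `K`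
    set φ := algebraMap K (v.adicCompletion K) with hφ
    set Wv := W.baseChange (v.adicCompletion K) with hWv
    have hu0 : Valued.v (↑C.u⁻¹ : v.adicCompletion K) ≠ 0 := by simp
    set S : Set ((v.adicCompletion K) × (v.adicCompletion K) × (v.adicCompletion K) ×
        (v.adicCompletion K)) :=
      {p | Valued.v p.1 = Valued.v (↑C.u⁻¹ : v.adicCompletion K)} ∩
        {p | (Wv.polyVariableChange p).IsIntegral (v.adicCompletionIntegers K)} with hS_def
    have hO : IsOpen {x : v.adicCompletion K | Valued.v x ≤ 1} :=
      Valued.isOpen_valuationSubring (v.adicCompletion K)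
    have hopen : IsOpen {p | (Wv.polyVariableChange p).IsIntegral (v.adicCompletionIntegers K)} := by
      simp only [isIntegral_iff_forall_mem_range,
        ← valued_le_one_iff_mem_range_adicCompletionIntegers, Set.setOf_and]
      exact (hO.preimage Wv.continuous_polyVariableChange_a₁).inter <|
        (hO.preimage Wv.continuous_polyVariableChange_a₂).inter <|
        (hO.preimage Wv.continuous_polyVariableChange_a₃).inter <|
        (hO.preimage Wv.continuous_polyVariableChange_a₄).inter (hO.preimage Wv.continuous_polyVariableChange_a₆)
    have hS : S ∈ nhds ((↑C.u⁻¹ : v.adicCompletion K), C.r, C.s, C.t) := by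
      refine Filter.inter_mem ?_ (hopen.mem_nhds ?_)
      · exact continuous_fst.continuousAt.preimage_mem_nhds (Valued.locally_const hu0)
      · simpa only [Set.mem_setOf_eq, ← variableChange_eq_polyVariableChange] using hC
    have hd : DenseRange φ := HeightOneSpectrum.denseRange_algebraMap K v
    obtain ⟨⟨w', r', s', t'⟩, hwv, hint⟩ := (hd.prodMap (hd.prodMap (hd.prodMap hd))).mem_nhds hS
    simp only [Prod.map_apply, Set.mem_setOf_eq] at hwv hint
    have hw' : w' ≠ 0 := by
      rintro rfl
      rw [map_zero, Valuation.map_zero] at hwv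
      exact hu0 hwv.symm
    set C' : VariableChange K := ⟨(Units.mk0 w' hw')⁻¹, r', s', t'⟩ with hC'_def
    have hC'W : (C' • W).baseChange (v.adicCompletion K) =
        Wv.polyVariableChange (φ w', φ r', φ s', φ t') := by
      rw [variableChange_eq_polyVariableChange, baseChange, map_polyVariableChange]
      simp [C', hWv, hφ, baseChange]
    have hint' : (C' • W).IsIntegral (v.valuation K).integer := by
      rw [← isIntegralAt_iff_isIntegral_integer, IsIntegralAt, hC'W]
      exact hint
    have key := H C' hint'
    rw [variableChange_Δ, inv_inv, Units.val_mk0, Valuation.map_mul, Valuation.map_pow,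
      ← valued_algebraMap_adicCompletion v w', ← valued_algebraMap_adicCompletion v W.Δ,
      ← hφ, hwv] at key
    rw [variableChange_Δ, Valuation.map_mul, Valuation.map_pow]
    simpa only [hWv, baseChange, map_Δ] using key

end Comparison

end WeierstrassCurve
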